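import Mathlib.Analysis.Calculus.MeanValue
import Mathlib.Analysis.Calculus.ContDiff.Basic
import Mathlib.Analysis.InnerProductSpace.Calculus
import Mathlib.Topology.Compactness.Compact
import HarnessLib

/-!
# A uniform fibrewise inverse-function estimate

Topic `Literature/Topology/FourManifolds` (fact seat
`provefact-Literature.Topology.FourManifolds.Matvey-69322e0896`, rung (H4)
`Literature.Topology.FourManifolds.Matveyev1996_partOne_and_fact_of_dualSpheres`;
infrastructure for the regular neighbourhood `Nd_N(S_* ∪ P_*)` of the middle-level
configuration, Matveyev 1996, p. 1, whose defining function near a sphere is the squared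
length `‖G(x, w)‖²` of a *modified* fibre coordinate `G` of the tube, equal to the honest
fibre coordinate `w` far from the crossings and to a chart coordinate near them).  The
situation is that of the tubular neighbourhood theorem read in a trivialised normal bundle
(Hirsch, *Differential Topology* (1976), Ch. 4 §5, proof of Thm. 5.1; Lang, *Fundamentals
of Differential Geometry* (1999), IV §5: a map of the total space which is the identity on
the zero section and whose fibre derivative along the zero section is the identity is a
local diffeomorphism near the zero section, injective on a uniformly thin tube over a
compact set): a `C¹` map `G : E × F → F` on an open set `Ω ⊇ K × {0}`, `K ⊆ E` compact,
with `G(x, 0) = 0` and `∂G/∂w (x, 0) = id` for `x ∈ K`.  Everything here is proved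
(no definitions, no named facts):

* `Literature.Topology.FourManifolds.fderiv_fibre_eq_comp_inr` — the fibre derivative is
  `dG_{(x, w)} ∘ inr`;
* `Literature.Topology.FourManifolds.exists_forall_norm_fderiv_fibre_sub_id_le` — **uniform
  control of the fibre derivative**: for every `c > 0` there is `δ > 0` with
  `K × B̄(0, δ) ⊆ Ω` and `‖∂G/∂w (x, w) - id‖ ≤ c` on it (continuity of `dG` and the tube
  lemma over the compact `K`);
* `Literature.Topology.FourManifolds.norm_sub_le_of_fderiv_fibre` — on such a tube with
  `c ≤ 1/2`, `‖(G(x, w₁) - G(x, w₂)) - (w₁ - w₂)‖ ≤ ½ ‖w₁ - w₂‖` (mean value inequality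
  for `w ↦ G(x, w) - w` on the convex ball), whence
  `Literature.Topology.FourManifolds.injOn_fibre_of_fderiv_fibre` (each `G(x, ·)` is
  injective on `B̄(0, δ)`) and `Literature.Topology.FourManifolds.apply_ne_zero_of_fderiv_fibre`
  (`G(x, w) ≠ 0` for `0 < ‖w‖ ≤ δ`);
* `Literature.Topology.FourManifolds.fderiv_norm_sq_fibre_ne_zero` — for an inner product
  space `F`: where `‖∂G/∂w - id‖ ≤ 1/2` and `G(x, w) ≠ 0`, the differential of
  `w ↦ ‖G(x, w)‖²` does not vanish (its value on `v = G(x, w)` is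
  `2⟪G, G + (∂G/∂w - id) G⟫ ≥ ‖G‖² > 0`) — so the squared modified fibre distance has no
  critical points off the zero section in the thin tube.

## References

* M. W. Hirsch, *Differential Topology*, GTM 33 (1976), Ch. 4 §5, Thm. 5.1 and its proof.
  [HirschDT1976]
* S. Lang, *Fundamentals of Differential Geometry*, GTM 191 (1999), Ch. IV §5 (existence of
  tubular neighbourhoods; the fibrewise inverse mapping argument). [Lang1999]
* R. Matveyev, *A decomposition of smooth simply-connected h-cobordant 4-manifolds*,
  J. Differential Geom. 44 (1996); arXiv:dg-ga/9505001, p. 1 (`V₀ = Nd_N(S_* ∪ P_*)`).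
  [Matveyev1996]
-/

open Set Function Metric
open scoped Topology InnerProductSpace

noncomputable section

namespace Literature.Topology.FourManifolds

section Fibre

variable {E F : Type*} [NormedAddCommGroup E] [NormedSpace ℝ E] [NormedAddCommGroup F]
  [NormedSpace ℝ F] {G : E × F → F} {Ω : Set (E × F)}

/-- The fibre derivative of `G` at `(x, w)` is the full derivative composed with the inclusion
of the fibre: `d(G(x, ·))_w = dG_{(x, w)} ∘ inr`. [folklore] -/
theorem fderiv_fibre_eq_comp_inr {p : E × F} (hG : DifferentiableAt ℝ G p) :
    fderiv ℝ (fun w => G (p.1, w)) p.2 = (fderiv ℝ G p).comp (ContinuousLinearMap.inr ℝ E F) := by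
  have h := hG.hasFDerivAt.comp p.2 (hasFDerivAt_prodMk_right (𝕜 := ℝ) p.1 p.2)
  exact h.fderiv

/-- **Uniform control of the fibre derivative near the zero section.**  Let `G : E × F → F`
be `C¹` on an open set `Ω` containing `K × {0}` for a compact `K ⊆ E`, with fibre derivative
the identity along `K × {0}`.  Then for every `c > 0` there is `δ > 0` such that the tube
`K × B̄(0, δ)` lies in `Ω` and `‖∂G/∂w (x, w) - id‖ ≤ c` for `x ∈ K`, `‖w‖ ≤ δ` (the fibre
derivative `dG ∘ inr` is continuous on `Ω`, so the set where it is `c`-close to the identity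
is an open neighbourhood of `K × {0}`, which contains a uniform tube by the tube lemma).
(Hirsch 1976, Ch. 4 §5, proof of Thm. 5.1; Lang 1999, IV §5.) [cite: HirschDT1976, Ch. 4 §5, proof of Thm. 5.1] -/
theorem exists_forall_norm_fderiv_fibre_sub_id_le (hΩ : IsOpen Ω) (hG : ContDiffOn ℝ 1 G Ω)
    {K : Set E} (hK : IsCompact K) (hK0 : ∀ x ∈ K, (x, (0 : F)) ∈ Ω)
    (hid : ∀ x ∈ K, fderiv ℝ (fun w => G (x, w)) 0 = ContinuousLinearMap.id ℝ F)
    {c : ℝ} (hc : 0 < c) :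
    ∃ δ : ℝ, 0 < δ ∧ (∀ x ∈ K, ∀ w : F, ‖w‖ ≤ δ → (x, w) ∈ Ω) ∧
      ∀ x ∈ K, ∀ w : F, ‖w‖ ≤ δ →
        ‖fderiv ℝ (fun w' => G (x, w')) w - ContinuousLinearMap.id ℝ F‖ ≤ c := by
  -- the fibre derivative as a continuous function on `Ω`
  set D : E × F → F →L[ℝ] F := fun p => (fderiv ℝ G p).comp (ContinuousLinearMap.inr ℝ E F)
    with hD
  have hDc : ContinuousOn D Ω := by
    have h1 : ContinuousOn (fderiv ℝ G) Ω := hG.continuousOn_fderiv_of_isOpen hΩ le_rfl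
    exact isBoundedBilinearMap_comp.continuous.comp_continuousOn
      (h1.prodMk continuousOn_const)
  have hDeq : ∀ p ∈ Ω, fderiv ℝ (fun w => G (p.1, w)) p.2 = D p := fun p hp =>
    fderiv_fibre_eq_comp_inr ((hG.differentiableOn one_ne_zero p hp).differentiableAt
      (hΩ.mem_nhds hp))
  -- the open set where it is `c`-close to the identity
  set W : Set (E × F) := {p ∈ Ω | ‖D p - ContinuousLinearMap.id ℝ F‖ < c} with hW
  have hWo : IsOpen W := by
    have : ContinuousOn (fun p => ‖D p - ContinuousLinearMap.id ℝ F‖) Ω :=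
      (hDc.sub continuousOn_const).norm
    exact this.isOpen_inter_preimage hΩ isOpen_Iio
  have hKW : K ×ˢ ({0} : Set F) ⊆ W := by
    rintro ⟨x, w⟩ ⟨hx, hw⟩
    rw [mem_singleton_iff] at hw
    subst hw
    refine ⟨hK0 x hx, ?_⟩
    show ‖D (x, 0) - ContinuousLinearMap.id ℝ F‖ < c
    rw [← hDeq (x, 0) (hK0 x hx), hid x hx, sub_self, norm_zero]
    exact hc
  -- a uniform tube inside it
  obtain ⟨u, t, -, ht, hKu, h0t, hut⟩ := generalized_tube_lemma hK isCompact_singleton hWo hKW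
  have h0 : (0 : F) ∈ t := h0t (mem_singleton _)
  obtain ⟨ε, hε, hball⟩ := Metric.isOpen_iff.1 ht 0 h0
  have hmem : ∀ x ∈ K, ∀ w : F, ‖w‖ ≤ ε / 2 → (x, w) ∈ W := fun x hx w hw =>
    hut ⟨hKu hx, hball (by rw [mem_ball, dist_zero_right]; linarith)⟩
  refine ⟨ε / 2, half_pos hε, fun x hx w hw => (hmem x hx w hw).1, fun x hx w hw => ?_⟩
  have hp := hmem x hx w hw
  rw [hDeq (x, w) hp.1]
  exact hp.2.le

/-- **The contraction estimate on a thin tube**: if `‖∂G/∂w (x, w) - id‖ ≤ 1/2` for all `w` in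
the closed ball `B̄(0, δ)` (and these points lie in the open set where `G` is `C¹`), then
`‖(G(x, w₁) - G(x, w₂)) - (w₁ - w₂)‖ ≤ ½ ‖w₁ - w₂‖` for `w₁, w₂ ∈ B̄(0, δ)`: the mean value
inequality for `w ↦ G(x, w) - w` on the convex ball. [cite: HirschDT1976, Ch. 4 §5, proof of Thm. 5.1] -/
theorem norm_sub_le_of_fderiv_fibre (hΩ : IsOpen Ω) (hG : ContDiffOn ℝ 1 G Ω) {x : E}
    {δ : ℝ} (hmem : ∀ w : F, ‖w‖ ≤ δ → (x, w) ∈ Ω)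
    (hle : ∀ w : F, ‖w‖ ≤ δ →
      ‖fderiv ℝ (fun w' => G (x, w')) w - ContinuousLinearMap.id ℝ F‖ ≤ 1 / 2)
    {w₁ w₂ : F} (hw₁ : ‖w₁‖ ≤ δ) (hw₂ : ‖w₂‖ ≤ δ) :
    ‖(G (x, w₁) - G (x, w₂)) - (w₁ - w₂)‖ ≤ 1 / 2 * ‖w₁ - w₂‖ := by
  have hdiff : ∀ w ∈ closedBall (0 : F) δ, DifferentiableAt ℝ (fun w' => G (x, w') - w') w := by
    intro w hw
    rw [mem_closedBall, dist_zero_right] at hw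
    have hGd : DifferentiableAt ℝ G (x, w) :=
      (hG.differentiableOn one_ne_zero _ (hmem w hw)).differentiableAt (hΩ.mem_nhds (hmem w hw))
    exact (hGd.comp w ((differentiableAt_const _).prodMk differentiableAt_id)).sub
      differentiableAt_id
  have hbound : ∀ w ∈ closedBall (0 : F) δ,
      ‖fderiv ℝ (fun w' => G (x, w') - w') w‖ ≤ 1 / 2 := by
    intro w hw
    rw [mem_closedBall, dist_zero_right] at hw
    have hGd : DifferentiableAt ℝ G (x, w) :=
      (hG.differentiableOn one_ne_zero _ (hmem w hw)).differentiableAt (hΩ.mem_nhds (hmem w hw))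
    have h1 : DifferentiableAt ℝ (fun w' => G (x, w')) w :=
      hGd.comp w ((differentiableAt_const _).prodMk differentiableAt_id)
    have hd : HasFDerivAt (fun w' => G (x, w') - w')
        (fderiv ℝ (fun w' => G (x, w')) w - ContinuousLinearMap.id ℝ F) w :=
      h1.hasFDerivAt.sub (hasFDerivAt_id w)
    rw [hd.fderiv]
    exact hle w hw
  have h := (convex_closedBall (0 : F) δ).norm_image_sub_le_of_norm_fderiv_le hdiff hbound
    (mem_closedBall_zero_iff.2 hw₂) (mem_closedBall_zero_iff.2 hw₁)
  have heq : (G (x, w₁) - w₁) - (G (x, w₂) - w₂) = (G (x, w₁) - G (x, w₂)) - (w₁ - w₂) := by abel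
  rw [heq] at h
  exact h

/-- **Fibrewise injectivity on a thin tube**: under the hypotheses of
`norm_sub_le_of_fderiv_fibre`, `w ↦ G(x, w)` is injective on `B̄(0, δ)`.
[cite: HirschDT1976, Ch. 4 §5, proof of Thm. 5.1] -/
theorem injOn_fibre_of_fderiv_fibre (hΩ : IsOpen Ω) (hG : ContDiffOn ℝ 1 G Ω) {x : E}
    {δ : ℝ} (hmem : ∀ w : F, ‖w‖ ≤ δ → (x, w) ∈ Ω)
    (hle : ∀ w : F, ‖w‖ ≤ δ →
      ‖fderiv ℝ (fun w' => G (x, w')) w - ContinuousLinearMap.id ℝ F‖ ≤ 1 / 2) :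
    InjOn (fun w => G (x, w)) (closedBall (0 : F) δ) := by
  intro w₁ hw₁ w₂ hw₂ heq
  rw [mem_closedBall, dist_zero_right] at hw₁ hw₂
  have h := norm_sub_le_of_fderiv_fibre hΩ hG hmem hle hw₁ hw₂
  have heq' : G (x, w₁) - G (x, w₂) = 0 := sub_eq_zero.2 heq
  rw [heq', zero_sub, norm_neg] at h
  have : ‖w₁ - w₂‖ = 0 := by nlinarith [norm_nonneg (w₁ - w₂)]
  exact sub_eq_zero.1 (norm_eq_zero.1 this)

/-- **The modified fibre coordinate vanishes only on the zero section** (in the thin tube):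
under the hypotheses of `norm_sub_le_of_fderiv_fibre` and `G(x, 0) = 0`, `G(x, w) ≠ 0` for
`0 < ‖w‖ ≤ δ`. [cite: HirschDT1976, Ch. 4 §5, proof of Thm. 5.1] -/
theorem apply_ne_zero_of_fderiv_fibre (hΩ : IsOpen Ω) (hG : ContDiffOn ℝ 1 G Ω) {x : E}
    {δ : ℝ} (hmem : ∀ w : F, ‖w‖ ≤ δ → (x, w) ∈ Ω)
    (hle : ∀ w : F, ‖w‖ ≤ δ →
      ‖fderiv ℝ (fun w' => G (x, w')) w - ContinuousLinearMap.id ℝ F‖ ≤ 1 / 2)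
    (h0 : G (x, 0) = 0) {w : F} (hw : ‖w‖ ≤ δ) (hw0 : w ≠ 0) : G (x, w) ≠ 0 := by
  intro hG0
  have hδ : 0 ≤ δ := (norm_nonneg w).trans hw
  have h := injOn_fibre_of_fderiv_fibre hΩ hG hmem hle (mem_closedBall_zero_iff.2 hw)
    (mem_closedBall_zero_iff.2 (by rw [norm_zero]; exact hδ)) (hG0.trans h0.symm)
  exact hw0 h

end Fibre

/-! ### The squared modified fibre distance has no critical points off the zero section -/

section NormSq

variable {E F : Type*} [NormedAddCommGroup F] [InnerProductSpace ℝ F] {G : E × F → F}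

/-- **The squared modified fibre distance has no critical points off the zero section.**  If
`w ↦ G(x, w)` is differentiable at `w` with `‖∂G/∂w (x, w) - id‖ ≤ 1/2` and `G(x, w) ≠ 0`,
then the differential of `w ↦ ‖G(x, w)‖²` at `w` is not zero: its value on the vector
`G(x, w)` is `2⟪G, ∂G/∂w · G⟫ = 2(‖G‖² + ⟪G, (∂G/∂w - id) G⟫) ≥ ‖G‖² > 0`. [folklore] -/
theorem fderiv_norm_sq_fibre_ne_zero {x : E} {w : F}
    (hd : DifferentiableAt ℝ (fun w' => G (x, w')) w)
    (hle : ‖fderiv ℝ (fun w' => G (x, w')) w - ContinuousLinearMap.id ℝ F‖ ≤ 1 / 2)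
    (hne : G (x, w) ≠ 0) : fderiv ℝ (fun w' => ‖G (x, w')‖ ^ 2) w ≠ 0 := by
  set L := fderiv ℝ (fun w' => G (x, w')) w with hL
  set g := G (x, w) with hg
  have hder : HasFDerivAt (fun w' => ‖G (x, w')‖ ^ 2) (2 • (innerSL ℝ g).comp L) w :=
    hd.hasFDerivAt.norm_sq
  rw [hder.fderiv]
  intro h0
  have heval := congrArg (fun T : F →L[ℝ] ℝ => T g) h0
  simp only [smul_apply, ContinuousLinearMap.comp_apply, innerSL_apply_apply, zero_apply] at heval
  -- `heval : 2 • ⟪g, L g⟫ = 0`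
  have heval' : ⟪g, L g⟫_ℝ = 0 := by simpa using heval
  -- `⟪g, L g⟫ = ‖g‖² + ⟪g, (L - id) g⟫ ≥ ‖g‖² - ½ ‖g‖² > 0`
  have hsplit : ⟪g, L g⟫_ℝ = ‖g‖ ^ 2 + ⟪g, (L - ContinuousLinearMap.id ℝ F) g⟫_ℝ := by
    rw [sub_apply, ContinuousLinearMap.id_apply, inner_sub_right,
      real_inner_self_eq_norm_sq]
    ring
  have hbound : |⟪g, (L - ContinuousLinearMap.id ℝ F) g⟫_ℝ| ≤ 1 / 2 * ‖g‖ ^ 2 := by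
    calc |⟪g, (L - ContinuousLinearMap.id ℝ F) g⟫_ℝ| ≤ ‖g‖ * ‖(L - ContinuousLinearMap.id ℝ F) g‖ :=
          abs_real_inner_le_norm _ _
      _ ≤ ‖g‖ * (1 / 2 * ‖g‖) := by
          gcongr
          exact (ContinuousLinearMap.le_opNorm _ _).trans (by gcongr)
      _ = 1 / 2 * ‖g‖ ^ 2 := by ring
  have hpos : 0 < ‖g‖ ^ 2 := by positivity
  have hge : ⟪g, L g⟫_ℝ ≥ 1 / 2 * ‖g‖ ^ 2 := by
    rw [hsplit]
    have := neg_abs_le ⟪g, (L - ContinuousLinearMap.id ℝ F) g⟫_ℝ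
    linarith
  rw [heval'] at hge
  linarith

end NormSq

end Literature.Topology.FourManifolds

end
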